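import Literature.AnabelianGeometry.SemiGraphs.MetabelianLeafStarEscapeNotVerticial
import Literature.AnabelianGeometry.SemiGraphs.TemperedAnchoredCompactOfAbelianEdges
import Literature.AnabelianGeometry.SemiGraphs.TemperedPiPointSeqThroughVertex
import Literature.AnabelianGeometry.SemiGraphs.TemperedPiBranchStabilizerRecentred
import Literature.AnabelianGeometry.SemiGraphs.TemperedMaximalCompactSelfOfEscaping
import Literature.AnabelianGeometry.SemiGraphs.ThetaRayFrameOrder
import Literature.AnabelianGeometry.SemiGraphs.TemperedCompactInVerticialAt
import Literature.AnabelianGeometry.SemiGraphs.TemperedCompactVerticialOrCommutative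
import HarnessLib

/-!
# The escaping procyclic `⟨c⟩‾ ≅ ℤ_p` of `π₁^temp(𝒢⋆(p))` is ITSELF a maximal compact subgroup
# («T37iv-ANCHOR-FREE@RAYLESS-STAR», file B2: the sharp structure)

Mochizuki, *Semi-graphs of anabelioids*, Publ. RIMS **42** (2006), §3, Theorem 3.7 (iv), manuscript p. 41
("the maximal compact subgroups of `π₁^temp(𝒢)` are precisely the verticial subgroups"), Remark 2.2.1 p. 24
(branch stabilisers are conjugates of the branch group) [cite: MochizukiSemiAnbd2006, Thm 3.7(iv) p.41].

PROOF-ONLY file (abc-iut cell, layer L3, row «T37iv-ANCHOR-FREE@RAYLESS-STAR» (L3-lead γ81 (b)/γ82 (2)/γ88 (1)),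
seat abc-iut-L3-t8 gen 7; no definition, no named fact).  At the canonical chart of the rayless star `𝒢⋆(p)`
(abc-iut-L3-t8 gen 6), let `C₀ = ⟨c⟩‾` be the escaping compact procyclic subgroup of `exists_escapeLimit`
(`MetabelianLeafStarEscapeElement.lean`), which lies in no verticial subgroup (file A,
`escapeLimit_not_le_verticial`).  abc-iut-w6-d063 proved at the RAY `𝒢_θ` that the escaping compact is itself
maximal compact by a cardinality squeeze on far edge stabilisers ("edge-rigid"); the star has diameter two and no
heights, so a different certificate is needed.  THIS FILE: **every compact `K ⊇ C₀` equals `C₀`**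
(`le_escape_of_isCompact_of_ge`), hence `C₀` is a MAXIMAL compact subgroup (`escape_isMaximalCompactSubgroup`),
ANCHOR-FREE, COMMUTATIVE and NON-VERTICIAL — answering L3-lead γ82 (2) «is `⟨c⟩‾` contained in a STRICTLY larger
compact subgroup?»: NO.  Proof:

1. (abc-iut-w6-d064's case analysis, `TemperedCompactVerticialOrCommutative`) if the `K`-fixed subtree of `𝒢_{∞,j}`
   is ONE vertex for cofinally many `j`, the fixed vertices are compatible and `K` lies in a verticial subgroup by
   (I2) — impossible, since `C₀ ⊆ K` does not; so from some level on `K` fixes two vertices, hence a BRANCH `β` at a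
   fixed vertex (`exists_fixed_branch_of_two_fixed_vertices`), and by abc-iut-w6-d064's one-conjugator form of
   Rmk 2.2.1 (`exists_conj_forall_gal_brHom_of_branchMap_eq`) every `ρ_m(g)`, `g ∈ K`, lies in the image of ONE
   continuous homomorphism `τ : ℤ_p = Π_e → Gal(𝒢_{∞,m}/𝒢)`, i.e. in the CYCLIC `p`-group `⟨e⟩`, `e = τ(1)`
   (`mem_zpowers_map_of_dense`, `exists_orderOf_eq_prime_pow_of_tendsto`);
2. CERTIFICATE (file A, `escapeLimit_exists_phi0`): the torsor character `Φ^{(0)} : π₁^temp → ℤ/p` kills `ker ρ_m`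
   and has `Φ^{(0)}(c) ≠ 0`; writing `ρ_m(c) = e^λ`, `p ∣ λ` would make `Φ^{(0)}(c)` a `p`-th power, i.e. `0` — so
   `p ∤ λ`, and by Bézout `e ∈ ⟨ρ_m(c)⟩`: `ρ_m(K) = ⟨ρ_m(c)⟩` at every deep level;
3. SQUEEZE (`mem_topologicalClosure_of_forall_proj`, abc-iut-L3 lineage): an element whose level components are
   those of powers of `c` lies in `cl⟨c⟩ = C₀`.

Corollaries: `escape_eq_of_isMaximalCompactSubgroup_of_ge` (the maximal compact subgroups containing `c` are
exactly `C₀`), `metabelianLeafStar_exists_procyclic_exotic_maximalCompact` (∃ a procyclic commutative anchor-free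
maximal compact subgroup in no verticial subgroup); the verdict `¬ MaximalCompactIffVerticialAt (metabelianLeafStar p)`
itself is file B1's `metabelianLeafStar_not_maximalCompactIffVerticialAt`.  Honest framing: OUR typed tempered fundamental group of OUR
countable carrier; print's Thm 3.7 (iv) at finite `𝔾` untouched; nothing here bears on [IUTchIII] Cor. 3.12; no
side taken; typed ≠ proved.
-/

noncomputable section

open CategoryTheory Topology Multiplicative Filter

namespace Literature.AnabelianGeometry.SemiGraphs

open IwahoriWitness

/-! ### Generic: `ℤ_p`-powers and Bézout in a group -/

/-- In `Multiplicative ℤ_[p]`: `(ofAdd 1)^{p^k} → 1`. [cite: RibesZalesskii2010, §4.1] -/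
theorem PadicInt.tendsto_ofAdd_one_pow_prime_pow (p : ℕ) [hp : Fact p.Prime] :
    Tendsto (fun k : ℕ => (ofAdd (1 : ℤ_[p])) ^ p ^ k) atTop (𝓝 1) := by
  have hp1 : ‖(p : ℤ_[p])‖ < 1 := by
    rw [PadicInt.norm_p]
    exact inv_lt_one_of_one_lt₀ (by exact_mod_cast hp.out.one_lt)
  have h1 : Tendsto (fun k : ℕ => ((p : ℤ_[p]) ^ k)) atTop (𝓝 0) :=
    tendsto_pow_atTop_nhds_zero_of_norm_lt_one hp1
  have h2 : (fun k : ℕ => (ofAdd (1 : ℤ_[p])) ^ p ^ k) = fun k => ofAdd ((p : ℤ_[p]) ^ k) := by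
    funext k
    rw [← ofAdd_nsmul, nsmul_eq_mul, mul_one, Nat.cast_pow]
  rw [h2, ← ofAdd_zero]
  exact (continuous_ofAdd.tendsto 0).comp h1

/-- Bézout in a group: if `e^{p^s} = 1` and `p ∤ λ`, then `e` is a power of `e^λ`.
[cite: RibesZalesskii2010, §2.3] -/
theorem exists_zpow_zpow_eq_self_of_not_dvd {G : Type*} [Group G] {p : ℕ} (hp : p.Prime) {e : G} {s : ℕ}
    (hs : e ^ p ^ s = 1) {l : ℤ} (hl : ¬ (p : ℤ) ∣ l) : ∃ v : ℤ, (e ^ l) ^ v = e := by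
  have hpi : Prime (p : ℤ) := Nat.prime_iff_prime_int.mp hp
  have hcop : IsCoprime ((p : ℤ) ^ s) l := ((Prime.coprime_iff_not_dvd hpi).mpr hl).pow_left
  obtain ⟨u, v, huv⟩ := hcop
  refine ⟨v, ?_⟩
  have hps : e ^ ((p : ℤ) ^ s) = 1 := by rw [← Int.natCast_pow, zpow_natCast, hs]
  calc (e ^ l) ^ v = (e ^ ((p : ℤ) ^ s)) ^ u * (e ^ l) ^ v := by rw [hps, one_zpow, one_mul]
    _ = e ^ ((p : ℤ) ^ s * u + l * v) := by rw [zpow_add, zpow_mul, zpow_mul]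
    _ = e := by rw [show (p : ℤ) ^ s * u + l * v = 1 by linear_combination huv, zpow_one]

namespace ProfiniteSemiGraph

variable {p : ℕ} [hp : Fact p.Prime] {h36 : (metabelianLeafStar p).Prop36Hypotheses}
  (P₀ : ((metabelianLeafStar p).galoisLevelData h36).PointSeq h36.isCountable (leafStarCentre p))

/-! ### Every compact subgroup containing the escaping `⟨c⟩‾` equals it -/

/-- **`K` compact, `⟨c⟩‾ ⊆ K` ⇒ `K ⊆ ⟨c⟩‾`** (canonical chart of `𝒢⋆(p)`; `c` as delivered by `exists_escapeLimit P₀`).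
Steps 1–3 of the module docstring: cofinally-single fixed vertices would put `K` in a verticial subgroup (impossible
by file A); a fixed branch at a fixed vertex puts `ρ_m(K)` in a cyclic `p`-group `⟨e⟩` (abc-iut-w6-d064); the mod-`p`
certificate `Φ^{(0)}(c) ≠ 0` forces `⟨e⟩ = ⟨ρ_m(c)⟩`; squeeze. [cite: MochizukiSemiAnbd2006, Thm 3.7(iv) p.41] -/
theorem le_escape_of_isCompact_of_ge (c : ((metabelianLeafStar p).galoisLevelData h36).temperedPi h36.isCountable)
    (N : ℕ → ℕ)
    (hcN : ∀ j k, N j ≤ k → ((metabelianLeafStar p).galoisLevelData h36).proj h36.isCountable j c =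
      ((metabelianLeafStar p).galoisLevelData h36).proj h36.isCountable j (escC P₀ k))
    (hact : ∀ j k, N j ≤ k → ((metabelianLeafStar p).galoisLevelData h36).treeAct h36.isCountable j c =
      ((metabelianLeafStar p).galoisLevelData h36).treeAct h36.isCountable j (escC P₀ k))
    (K : Subgroup ((metabelianLeafStar p).temperedPiChart h36).G)
    (hKc : IsCompact (K : Set ((metabelianLeafStar p).temperedPiChart h36).G))
    (hCK : (Subgroup.zpowers c).topologicalClosure ≤ K) :
    K ≤ (Subgroup.zpowers c).topologicalClosure := by
  classical
  haveI : NeZero p := ⟨hp.out.ne_zero⟩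
  set 𝔊 := metabelianLeafStar p with h𝔊
  let Dg := 𝔊.galoisLevelData h36
  have hc := h36.isCountable
  let D₀ : VerticialLevelData.{0} 𝔊 (𝔊.temperedPiChart h36) := verticialLevelData_temperedPiChart (h36 := h36)
  have hcC : c ∈ (Subgroup.zpowers c).topologicalClosure :=
    Subgroup.le_topologicalClosure _ (Subgroup.mem_zpowers c)
  have hno : ∀ (v : 𝔊.graph.Vertex) (H : Subgroup (𝔊.temperedPiChart h36).G),
      H ∈ verticialSubgroups (𝔊.temperedPiChart h36) v → ¬ (Subgroup.zpowers c).topologicalClosure ≤ H :=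
    fun v H hH => escapeLimit_not_le_verticial P₀ c N hcN hact hH
  -- [SemiAnbd] Lemma 1.8 (ii): `K` fixes a vertex of every `𝒢_{∞,j}`
  have hfixK : ∀ j : D₀.J, ∃ z : (D₀.tree j).Vertex, ∀ g ∈ K, (D₀.act j g).hom.vertexMap z = z :=
    fun j => D₀.exists_forall_mem_fixed_vertex_of_isCompact K hKc j
  by_cases hA : ∀ j₁ : D₀.J, ∃ j : D₀.J, j₁ ≤ j ∧ ∀ z z' : (D₀.tree j).Vertex,
      (∀ g ∈ K, (D₀.act j g).hom.vertexMap z = z) → (∀ g ∈ K, (D₀.act j g).hom.vertexMap z' = z') → z = z'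
  · /- (A) cofinally ONE fixed vertex: `K` lies in a verticial subgroup (abc-iut-w6-d064's argument) — absurd. -/
    exfalso
    choose φ hφle hφuniq using hA
    choose z hz using hfixK
    have hzimg : ∀ (i : D₀.J) (m : D₀.J) (h : φ i ≤ m), (D₀.trans h).vertexMap (z m) = z (φ i) := by
      intro i m h
      refine hφuniq i _ _ (fun g hg => ?_) (hz (φ i))
      rw [← D₀.trans_act_vertexMap h g (z m), hz m g hg]
    let y : ∀ i : D₀.J, (D₀.tree i).Vertex := fun i => (D₀.trans (hφle i)).vertexMap (z (φ i))
    have hy : ∀ ⦃i i' : D₀.J⦄ (h : i ≤ i'), (D₀.trans h).vertexMap (y i') = y i := by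
      intro i i' h
      obtain ⟨M, hM, hM'⟩ := exists_ge_ge (φ i) (φ i')
      change (D₀.trans h).vertexMap ((D₀.trans (hφle i')).vertexMap (z (φ i'))) =
        (D₀.trans (hφle i)).vertexMap (z (φ i))
      rw [← hzimg i M hM, ← hzimg i' M hM', D₀.trans_vertexMap_comp, D₀.trans_vertexMap_comp,
        D₀.trans_vertexMap_comp]
    have hfy : ∀ g ∈ K, ∀ i, (D₀.act i g).hom.vertexMap (y i) = y i := by
      intro g hg i
      change (D₀.act i g).hom.vertexMap ((D₀.trans (hφle i)).vertexMap (z (φ i))) =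
        (D₀.trans (hφle i)).vertexMap (z (φ i))
      rw [← D₀.trans_act_vertexMap (hφle i) g, hz (φ i) g hg]
    obtain ⟨v, H, hH, hst⟩ := D₀.stab y hy
    exact hno v H hH (hCK.trans fun g hg => hst g fun i => hfy g hg i)
  · /- (B) eventually TWO fixed vertices: a fixed branch at a fixed vertex; cyclic level images; certificate; squeeze. -/
    push Not at hA
    obtain ⟨j₁, hj₁⟩ := hA
    -- the certificate `Φ^{(0)}`
    obtain ⟨Φ, jΦ, -, hΦker, -, hΦne⟩ := escapeLimit_exists_phi0 P₀ c N hcN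
    -- ℕ-indexed restatement over the canonical tower (the level data of the canonical chart ARE the tower's trees)
    let j₁' : ℕ := j₁
    have hj₁' : ∀ j : ℕ, j₁' ≤ j → ∃ z z' : (Dg.tree j).Vertex,
        (∀ g ∈ K, (Dg.treeAct hc j g).hom.vertexMap z = z) ∧
          (∀ g ∈ K, (Dg.treeAct hc j g).hom.vertexMap z' = z') ∧ z ≠ z' :=
      fun j hj => hj₁ j hj
    intro g hg
    apply Dg.mem_topologicalClosure_of_forall_proj hc
    intro n
    -- work at a level `m` above `n`, `j₁`, `jΦ`
    obtain ⟨m, hnm, hj₁m, hΦm⟩ : ∃ m : ℕ, n ≤ m ∧ j₁' ≤ m ∧ jΦ ≤ m :=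
      ⟨max n (max j₁' jΦ), le_max_left _ _, le_trans (le_max_left _ _) (le_max_right _ _),
        le_trans (le_max_right _ _) (le_max_right _ _)⟩
    obtain ⟨z, z', hz, hz', hne⟩ := hj₁' m hj₁m
    -- a `K`-fixed branch `β` at the `K`-fixed vertex `z` (first step of the fixed geodesic `[z, z']`)
    obtain ⟨β, hβz, hβfix⟩ := D₀.exists_fixed_branch_of_two_fixed_vertices K m hne hz hz'
    -- a compatible point sequence through `z`; the branch `b` of `𝔾` under `β`, at the vertex `w` under `z`
    let w : 𝔊.graph.Vertex := (Dg.treeProj m).vertexMap z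
    let b : 𝔊.graph.Branch := (Dg.treeProj m).branchMap β
    obtain ⟨P, hP⟩ : ∃ P : Dg.PointSeq hc w, P.vertex m = z := exists_pointSeq_vertex_eq_galoisLevelData h36 m z
    have hb : 𝔊.graph.abuts b = some w := (Dg.treeProj m).abuts_branchMap β z hβz
    -- ONE conjugator for the whole branch stabiliser (abc-iut-w6-d064)
    obtain ⟨f, hf⟩ := P.exists_conj_forall_gal_brHom_of_branchMap_eq m b hb β rfl (hP.symm ▸ hβz)
    -- the homomorphism `τ : ℤ_p = Π_e → Gal(𝒢_{∞,m}/𝒢)`, `k ↦ σ_m^{f·b_*(k)·f⁻¹}`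
    let κ : 𝔊.Ge (𝔊.graph.edgeOf b) →* 𝔊.Gv w :=
      (MulAut.conj f).toMonoidHom.comp (𝔊.brHom b w hb).toMonoidHom
    have hconj : Continuous fun x : 𝔊.Gv w => f * x * f⁻¹ := by fun_prop
    have hκ : Continuous κ := hconj.comp (𝔊.brHom b w hb).continuous
    let τ₀ : 𝔊.Ge (𝔊.graph.edgeOf b) →* Dg.Gal hc m := (Dg.proj hc m).comp (P.decompHom.comp κ)
    have hτ₀ : Continuous τ₀ := (Dg.continuous_proj hc m).comp (P.continuous_decompHom.comp hκ)
    -- the edge group of `𝒢⋆(p)` IS `ℤ_p` (definitionally): retype the source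
    let τ : Multiplicative ℤ_[p] →* Dg.Gal hc m := τ₀
    have hτ : Continuous τ := hτ₀
    have hτ_apply : ∀ k, τ k = P.gal m (f * 𝔊.brHom b w hb k * f⁻¹) := fun k => rfl
    have hgen : (Subgroup.zpowers (ofAdd (1 : ℤ_[p]))).topologicalClosure = ⊤ :=
      FreeProPRankTwo.topologicalClosure_zpowers_ofAdd_one p
    -- every level component of `K` lies in `⟨τ 1⟩`
    have hKe : ∀ g' ∈ K, Dg.proj hc m g' ∈ Subgroup.zpowers (τ (ofAdd 1)) := by
      intro g' hg'
      obtain ⟨k, hk⟩ := hf g' (hβfix g' hg')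
      have h1 : τ k ∈ Subgroup.zpowers (τ (ofAdd 1)) := mem_zpowers_map_of_dense (ofAdd (1 : ℤ_[p])) hgen τ hτ k
      rw [hτ_apply] at h1
      rw [hk]
      exact h1
    -- `τ 1` is a `p`-element
    obtain ⟨s, hs⟩ := exists_orderOf_eq_prime_pow_of_tendsto p hp.out τ hτ (ofAdd (1 : ℤ_[p]))
      (PadicInt.tendsto_ofAdd_one_pow_prime_pow p)
    have hes : τ (ofAdd 1) ^ p ^ s = 1 := by rw [← hs]; exact pow_orderOf_eq_one _
    -- `ρ_m(c) = (τ 1)^λ` with `p ∤ λ` (certificate)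
    obtain ⟨l, hl⟩ := Subgroup.mem_zpowers_iff.mp (hKe c (hCK hcC))
    have hee : Dg.proj hc m (P.decompHom (f * 𝔊.brHom b w hb (ofAdd (1 : ℤ_[p])) * f⁻¹)) = τ (ofAdd 1) := by
      rw [hτ_apply]; exact P.proj_decompHom m _
    have hndvd : ¬ (p : ℤ) ∣ l := by
      rintro ⟨μ, rfl⟩
      apply hΦne
      have h1 : Dg.proj hc m
          (c * (P.decompHom (f * 𝔊.brHom b w hb (ofAdd (1 : ℤ_[p])) * f⁻¹) ^ ((p : ℤ) * μ))⁻¹) = 1 := by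
        rw [map_mul, map_inv, map_zpow, hee, hl, mul_inv_cancel]
      have h2 : Φ (c * (P.decompHom (f * 𝔊.brHom b w hb (ofAdd (1 : ℤ_[p])) * f⁻¹) ^ ((p : ℤ) * μ))⁻¹) = 1 :=
        hΦker m hΦm _ h1
      rw [map_mul, map_inv, mul_inv_eq_one] at h2
      rw [h2, map_zpow, mul_comm, zpow_mul, zpow_natCast]
      exact pow_prime_eq_one_zmod _
    -- Bézout: `τ 1 ∈ ⟨ρ_m(c)⟩`, so `ρ_m(g) ∈ ⟨ρ_m(c)⟩`
    obtain ⟨v, hv⟩ := exists_zpow_zpow_eq_self_of_not_dvd hp.out hes hndvd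
    obtain ⟨μ, hμ⟩ := Subgroup.mem_zpowers_iff.mp (hKe g hg)
    refine ⟨c ^ (v * μ), Subgroup.zpow_mem _ (Subgroup.mem_zpowers c) _, ?_⟩
    rw [← Dg.mapLE_proj hc hnm (c ^ (v * μ)), ← Dg.mapLE_proj hc hnm g, map_zpow, zpow_mul, ← hl, hv, hμ]

/-- **The escaping `⟨c⟩‾ ≅ ℤ_p` is a MAXIMAL compact subgroup of `π₁^temp(𝒢⋆(p))`** (canonical chart), lying in NO
verticial subgroup — a procyclic, commutative, anchor-free EXOTIC maximal compact subgroup; in particular no compact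
subgroup strictly contains it (L3-lead γ82 (2)). [cite: MochizukiSemiAnbd2006, Thm 3.7(iv) p.41] -/
theorem escape_isMaximalCompactSubgroup (c : ((metabelianLeafStar p).galoisLevelData h36).temperedPi h36.isCountable)
    (N : ℕ → ℕ)
    (hcN : ∀ j k, N j ≤ k → ((metabelianLeafStar p).galoisLevelData h36).proj h36.isCountable j c =
      ((metabelianLeafStar p).galoisLevelData h36).proj h36.isCountable j (escC P₀ k))
    (hC : IsCompact ((Subgroup.zpowers c).topologicalClosure :
      Set (((metabelianLeafStar p).galoisLevelData h36).temperedPi h36.isCountable)))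
    (hact : ∀ j k, N j ≤ k → ((metabelianLeafStar p).galoisLevelData h36).treeAct h36.isCountable j c =
      ((metabelianLeafStar p).galoisLevelData h36).treeAct h36.isCountable j (escC P₀ k)) :
    IsMaximalCompactSubgroup
        ((Subgroup.zpowers c).topologicalClosure : Subgroup ((metabelianLeafStar p).temperedPiChart h36).G) ∧
      ∀ (v : (metabelianLeafStar p).graph.Vertex) (H : Subgroup ((metabelianLeafStar p).temperedPiChart h36).G),
        H ∈ verticialSubgroups ((metabelianLeafStar p).temperedPiChart h36) v →
          ¬ (Subgroup.zpowers c).topologicalClosure ≤ H :=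
  ⟨⟨hC, fun K hK hCK => le_antisymm (le_escape_of_isCompact_of_ge P₀ c N hcN hact K hK hCK) hCK⟩,
    fun _ _ hH => escapeLimit_not_le_verticial P₀ c N hcN hact hH⟩

/-- **The maximal compact subgroups containing the escaping `⟨c⟩‾` are exactly `⟨c⟩‾`** (uniqueness of the exotic
maximal compact over `c`). [cite: MochizukiSemiAnbd2006, Thm 3.7(iv) p.41] -/
theorem escape_eq_of_isCompact_of_ge (c : ((metabelianLeafStar p).galoisLevelData h36).temperedPi h36.isCountable)
    (N : ℕ → ℕ)
    (hcN : ∀ j k, N j ≤ k → ((metabelianLeafStar p).galoisLevelData h36).proj h36.isCountable j c =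
      ((metabelianLeafStar p).galoisLevelData h36).proj h36.isCountable j (escC P₀ k))
    (hact : ∀ j k, N j ≤ k → ((metabelianLeafStar p).galoisLevelData h36).treeAct h36.isCountable j c =
      ((metabelianLeafStar p).galoisLevelData h36).treeAct h36.isCountable j (escC P₀ k))
    (K : Subgroup ((metabelianLeafStar p).temperedPiChart h36).G)
    (hKc : IsCompact (K : Set ((metabelianLeafStar p).temperedPiChart h36).G))
    (hCK : (Subgroup.zpowers c).topologicalClosure ≤ K) : K = (Subgroup.zpowers c).topologicalClosure :=
  le_antisymm (le_escape_of_isCompact_of_ge P₀ c N hcN hact K hKc hCK) hCK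

variable (p)

/-- **`π₁^temp(𝒢⋆(p))` has a PROCYCLIC exotic maximal compact subgroup** (canonical chart, every prime `p`,
hypothesis-free): a maximal compact subgroup of the form `⟨c⟩‾`, COMMUTATIVE, lying in NO verticial subgroup and
meeting every verticial subgroup trivially (anchor-free). [cite: MochizukiSemiAnbd2006, Thm 3.7(iv) p.41] -/
theorem metabelianLeafStar_exists_procyclic_exotic_maximalCompact (h36 : (metabelianLeafStar p).Prop36Hypotheses) :
    ∃ c : ((metabelianLeafStar p).temperedPiChart h36).G,
      IsMaximalCompactSubgroup
          ((Subgroup.zpowers c).topologicalClosure : Subgroup ((metabelianLeafStar p).temperedPiChart h36).G) ∧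
      (∀ (v : (metabelianLeafStar p).graph.Vertex) (H : Subgroup ((metabelianLeafStar p).temperedPiChart h36).G),
        H ∈ verticialSubgroups ((metabelianLeafStar p).temperedPiChart h36) v →
          ¬ (Subgroup.zpowers c).topologicalClosure ≤ H) ∧
      (∀ v : (metabelianLeafStar p).graph.Vertex,
        ((Subgroup.zpowers c).topologicalClosure : Subgroup ((metabelianLeafStar p).temperedPiChart h36).G) ∉
          verticialSubgroups ((metabelianLeafStar p).temperedPiChart h36) v) ∧
      ∀ g₁ ∈ (Subgroup.zpowers c).topologicalClosure, ∀ g₂ ∈ (Subgroup.zpowers c).topologicalClosure,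
        g₁ * g₂ = g₂ * g₁ := by
  obtain ⟨P₀⟩ := GaloisLevelData.nonempty_pointSeq h36 (leafStarCentre p)
  obtain ⟨c, N, hcN, hC, hact⟩ := exists_escapeLimit P₀
  obtain ⟨hmax, hno⟩ := escape_isMaximalCompactSubgroup P₀ c N hcN hC hact
  refine ⟨c, hmax, hno, fun v hv => hno v _ hv le_rfl, ?_⟩
  -- commutative: abc-iut-w6-d064's dichotomy (verticial-contained or commutative), the first branch excluded
  rcases metabelianLeafStar_le_verticial_or_commutative p ((metabelianLeafStar p).temperedPiChart h36)
      ((Subgroup.zpowers c).topologicalClosure) hmax.1 with ⟨v, H, hH, hle⟩ | hcomm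
  · exact absurd hle (hno v H hH)
  · exact hcomm

/- Remark.  `¬ MaximalCompactIffVerticialAt (metabelianLeafStar p)` is the tree's
`metabelianLeafStar_not_maximalCompactIffVerticialAt` (file B1, `MetabelianLeafStarExoticMaximalCompact.lean`, Zorn
route); the sharp structure above re-derives it with the explicit witness `⟨c⟩‾`
(`metabelianLeafStar_exists_procyclic_exotic_maximalCompact`). -/

end ProfiniteSemiGraph

end Literature.AnabelianGeometry.SemiGraphs

end
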